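import Summits.QuantumFields.BalabanUV.Beta.FP.ResidualModeIdentities

/-!
# `BalabanUV.Beta.FP.InducedGaugeFixing` — road «FP» for binder row D1, sub-row **RHOA-10b** of row RHOA-10 (items (a)(b) of the row,
# `LEAVES-FP.md` l.340; owner memo `N7-PROOF.v3.3.md` §2(a)(b) ∕ R-FP-24 (b), `GAMMA-DESIGN.md` §2 row «tilt identities»): «THE INDUCED GAUGE
# FIXING IS Ξ» — the multiplier blocks of the bordered inverse under the covariant (weighted) downdate, the regrouping letter of the
# gluon-vertex loops, and the LOCATED status of the memo's `R̃ := AΞAᵀ = R^g` — MODEL level, [folklore] finite matrices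

HONEST DEPENDENCY (page 1, mandatory): continuum YM on T⁴ ⇐ BetaPertH ∧ nine spine estimates (0/9 proved); BetaPertH ⇐ (D1) ∧ (D4) ∧
CAP+tail; G-an2-4 gates asym, D1 and NE2/3/4.  HONEST FRAMING (cell contract, verbatim): «discharging `BetaPertH` makes Bałaban's UV
stability UNCONDITIONAL — a real constructive-QFT result; it is NOT the continuum limit and NOT the Clay problem.»  THIS MODULE is [folklore]
finite-dimensional linear algebra over a field `𝕜` (`ℝ` for the one positivity statement) on the cell's own bordered-inverse dictionary
(`Beta.Composition.kkt ∕ blockProp`, `Beta.Envelope.minMap ∕ minMapL ∕ constrProp`, `Beta.CompositionSingular.flucCov ∕ minOp ∕ minOpL ∕ effForm`)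
and the landed road-FP model file `FP/ResidualModeIdentities` (t4-ne9-formalise-leaf-08-g28, sub-row IR-3-ID: `kktInv_weighted_downdate`,
`flucCov_weighted_downdate`, `flucCov_sub_deficit`, `weight_sub_deficitCov_eq`) BY NAME; no `def`, no `def … : Prop`, nothing cited, 0 `sorry`;
0 estimates; 0∕4 binders of row D1; NOT hbook, NOT hasym, NOT D1, NOT BetaPertH, NOT continuum, NOT Clay.

ABSOLUTE RULE (cell charter, verbatim): «No internally-minted statement may enter as a cited fact. Every hypothesis is either kernel-proved in this
package or a verbatim quotation of a PUBLISHED theorem with page reference. The manuscript(s) under audit are NOT citable for their own disputed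
steps — they are the thing under adjudication; programme-internal (2001/route/tribunal) claims are never citable.»

THE READING (owner memos N7-PROOF v3.3 §2–§3, GAMMA-DESIGN §1–§2; orientation only, nothing of it is asserted here).  The one shot in its covariant
inner gauge has fine form `H_cov = H − FᵀWF` (`H = H_BF` the full-Feynman form, invertible; `F` the raw deficit rows `Q′Δ⁻¹d^*`, `W = Mid⁻¹`,
`Mid = Q′Δ⁻²Q′ᵀ`), block averaging `Q`.  The bordered inverse `kkt(H_cov,Q)⁻¹ = [[Γ^{cov}, 𝓘^{cov}],[𝓘^{covT}, −𝔊]]` carries the legs of organisation γ's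
loops; (I5) of IR-3-ID gave its `₁₁` corner `Γ^{cov} = Γ₀ + Γ₀FᵀK_CFΓ₀` (`Γ₀ := flucCov H Q`, `K_C := (Mid − FΓ₀Fᵀ)⁻¹`).  N7-PROOF v3.3 §2(b): «the λλ-block of
`kkt(H_cov,Q)⁻¹` is `−(G_C − Ξ)`», `G_C := effForm H Q` (`= (QH⁻¹Qᵀ)⁻¹` for invertible `H`), «the induced gauge fixing of S2 IS `Ξ` exactly, `Ξ ⪰ 0`»,
with the memo's `Ξ := G_C d^c L_C⁻¹ d^{cT} G_C`; §2(a): «`R̃ := AΞAᵀ`, `Γ₀ + R̃ = Γ^{cov}` (`R̃ = R^g`)», `A := H⁻¹Qᵀ`, `R^g := Γ^{cov} − Γ₀`.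

CONTENT (any field `𝕜`; `ℝ` in §2's positivity statement).  Letters: `Γ₀ := flucCov H Q`, `𝓘 := minOp H Q`, `𝓘ᴸ := minOpL H Q`, `G_C := effForm H Q`,
`K := (W⁻¹ − FΓ₀Fᵀ)⁻¹`; the expression `Ξ := 𝓘ᴸ·Fᵀ·K·F·𝓘` is WRITTEN OUT everywhere (no definition is introduced).
* §1 THE THREE REMAINING CORNERS of `kktInv_weighted_downdate` (twins of (I5) `flucCov_weighted_downdate`), under `IsUnit (kkt H Q).det`,
  `IsUnit W.det`, `IsUnit (W⁻¹ − FΓ₀Fᵀ).det` ONLY (no invertibility of `H`): **`minOp_weighted_downdate`** `𝓘^{cov} = 𝓘 + Γ₀FᵀKF𝓘`,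
  **`minOpL_weighted_downdate`** `𝓘ᴸ^{cov} = 𝓘ᴸ + 𝓘ᴸFᵀKFΓ₀`, **`effForm_weighted_downdate`** `𝔊 = G_C − 𝓘ᴸFᵀKF𝓘` («λλ-block `= −(G_C − Ξ)`»);
  the `W := Mid⁻¹` forms `minOp_sub_deficit`, `effForm_sub_deficit` (`K = K_C`).
* §2 Ξ IN THE MEMO's LETTERS: `xi_eq_sandwich` (`Hᵀ = H`: `Ξ = (F𝓘)ᵀ·K·(F𝓘)`); **`xi_eq_coarse_sandwich`** (invertible symmetric `H`, `blockProp H Q`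
  invertible): `Ξ = G_C·S₀·K·S₀ᵀ·G_C` with `S₀ := Q H⁻¹ Fᵀ` and `G_C = (blockProp H Q)⁻¹` (IR-3-ID's raw letters; this is the memo's `G_C d^c L_C⁻¹ d^{cT} G_C`
  under the road dictionary `S₀ = d^c·Mid`, `L_C⁻¹ = Mid·K_C·Mid`, which is DISPLAYED there and not asserted here); over `ℝ`: **`posSemidef_xi`**
  (`Hᵀ = H`, `Mid − FΓ₀Fᵀ` positive definite ⟹ `Ξ ⪰ 0` at `K = K_C`); the value reading **`effForm_weighted_downdate_eq_value`**
  `𝔊 = (𝓘^{cov})ᵀ·H_cov·𝓘^{cov}` (`CompositionSingular.transpose_minOp_mul_mul_minOp` BY NAME; the variational half «= the constrained minimum» is row RHOA-1b, not here).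
* §3 THE REGROUPING LETTER of §2(a), generic trace algebra over `ℝ` (ANY square `P R^Q R̃` and vertices `H₁ H₂`; `Γ₀ := P − R^Q`):
  **`gluonLoops_regroup`**: `[½tr(PH₁PH₁) − ½tr(PH₂)] − [−½tr(R^QH₁R^QH₁) + tr(R^QH₁PH₁) − ½tr(R^QH₂)] − [−½tr(R̃H₁R̃H₁) − tr(R̃H₁Γ₀H₁) + ½tr(R̃H₂)]
  = ½tr((Γ₀+R̃)H₁(Γ₀+R̃)H₁) − ½tr((Γ₀+R̃)H₂)` — the memo's displayed C- and L-sector gluon-vertex loops regroup onto the legs `Γ₀ + R̃`, WHATEVER `R̃` is;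
  `Γ^{cov} = Γ₀ + R^g` with `R^g = Γ₀FᵀK_CFΓ₀` is (I5) `ResidualModeIdentities.flucCov_sub_deficit` BY NAME (not restated).
* §4 LOCATED — the status of «`R̃ := AΞAᵀ = R^g`»: the exact identity **`resCov_eq_conj_xi_add`** (invertible symmetric `H`, `blockProp H Q`, `Mid`, `Mid − FΓ₀Fᵀ`
  invertible): `R^g = A·Ξ·Aᵀ + (P·Fᵀ·K_C·F·P − P·Fᵀ·K_C·F·R^Q − R^Q·Fᵀ·K_C·F·P)` with `P := H⁻¹`, `A := PQᵀ`, `R^Q := minMap H Q·Q·P` (`Γ₀ = P − R^Q` is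
  `Envelope.constrProp` unfolded), and its consequence **`transpose_mul_resCov_mul_eq`**: `F·P·X = 0 → F·P·Y = 0 → Xᵀ·R^g·Y = Xᵀ·(AΞAᵀ)·Y`.  So §2(a)'s
  `AΞAᵀ = R^g` holds AGAINST LEGS KILLED BY `F·P` (on the road `F·P = Q′Δ⁻²d^*` by the BF Ward identity `d^*P = Δ⁻¹d^*`: against TRANSVERSE legs) and is NOT
  a matrix identity (exact-rational witnesses in the journal INTENT line of this sub-row: generic and structured toys, difference ≠ 0, transverse sandwich = 0).
  Under organisation γ (R-FP-25: legs = the blocks of `kkt(H_cov,Q)⁻¹` directly) nothing depends on it; under β's L-sector regrouping the three raw-leg terms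
  ride with the vertices that do not kill longitudinal legs (slice jets) — a bookkeeping line for RHOA-2∕6d, recorded, not an obstruction.
* §4b AT LOOP LEVEL the gloss is EXACT against vertices that kill the raw legs: **`vertex_mul_resCov_mul_vertex`** (`H₁ᵀ = H₁`, `F·H⁻¹·H₁ = 0 ⟹
  H₁·R^g·H₁ = H₁·AΞAᵀ·H₁`) and **`lsectorLoops_resCov_eq_conj_xi`**: for symmetric `H₁ H₂` with `F·H⁻¹·H₁ = 0 = F·H⁻¹·H₂` the L-sector bubble
  `tr(R̃H₁R̃H₁)`, cross-bubble `tr(R̃H₁Γ₀H₁)` and tadpole `tr(R̃H₂)` coincide at `R̃ = R^g` and `R̃ = AΞAᵀ` (generic `bubbles_eq_of_sandwich_eq`).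
* §5 (v1.1) **`effForm_sub_deficit_mul_coarseLeg`**: under (I2)'s `F·H⁻¹·Fᵀ = Mid`, `effForm (H − FᵀMid⁻¹F) Q · (Q·H⁻¹·Fᵀ) = 0` — the induced
  effective form kills the coarse raw legs `S₀` (the RHOA-10b cross-reader's junction P1, journal l.24297, as a tree theorem).
Provenance: NE7b formalisation swarm (idle-seat cross-cell kernel duty NE7b → road FP), unit b2b-balaban-t4-ne7b-formalise-leaf-02 gen 20
(prover-b2b-balaban-t4-ne7b-formalise-leaf-02-g20-0), 2026-08-21; sub-row RHOA-10b (items (a)(b) left out of the RHOA-10 holder's shape).  [folklore], 0 def, 0 cite, 0 sorry;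
v1.1 (same gen): + §5, earlier declarations byte-identical.
-/

namespace Summit.QuantumFields.BalabanUV.Beta.FP.InducedGaugeFixing

open scoped Matrix
open Matrix
open Literature.MathematicalPhysics.QuantumFieldTheory.Balaban1983to89.Beta.Composition (kkt blockProp det_kkt_ne_zero)
open Literature.MathematicalPhysics.QuantumFieldTheory.Balaban1983to89.Beta.Envelope (constrProp minMap minMapL)
open Literature.MathematicalPhysics.QuantumFieldTheory.Balaban1983to89.Beta.CompositionSingular (flucCov minOp minOpL effForm
  kktInv_eq_fromBlocks minOpL_eq_transpose blocks_eq_of_inv transpose_minOp_mul_mul_minOp)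
open Summit.QuantumFields.BalabanUV.Beta.FP.ResidualModeIdentities (kktInv_weighted_downdate flucCov_weighted_downdate flucCov_sub_deficit
  isUnit_det_kkt_weighted_downdate)

variable {𝕜 : Type*} [Field 𝕜]
variable {κ ν μ : Type*} [Fintype κ] [Fintype ν] [Fintype μ] [DecidableEq κ] [DecidableEq ν] [DecidableEq μ]

/-! ## §1 The three remaining corners of the bordered inverse after the weighted downdate -/

/-- [folklore] **THE MINIMISER UNDER THE WEIGHTED DOWNDATE** (the `₁₂` corner of `kktInv_weighted_downdate`): with `Γ₀ := flucCov H Q`,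
`𝓘 := minOp H Q`, `K := (W⁻¹ − FΓ₀Fᵀ)⁻¹`,  `minOp (H − FᵀWF) Q = 𝓘 + Γ₀·Fᵀ·K·F·𝓘`  under `IsUnit (kkt H Q).det`, `IsUnit W.det`,
`IsUnit (W⁻¹ − FΓ₀Fᵀ).det` ONLY. -/
theorem minOp_weighted_downdate (H : Matrix ν ν 𝕜) (Q : Matrix μ ν 𝕜) (F : Matrix κ ν 𝕜) (W : Matrix κ κ 𝕜)
    (h : IsUnit (kkt H Q).det) (hW : IsUnit W.det) (hM : IsUnit (W⁻¹ - F * flucCov H Q * Fᵀ).det) :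
    minOp (H - Fᵀ * W * F) Q = minOp H Q + flucCov H Q * Fᵀ * (W⁻¹ - F * flucCov H Q * Fᵀ)⁻¹ * F * minOp H Q := by
  have hX := kktInv_weighted_downdate H Q F W h hW hM
  rw [fromRows_mul, fromRows_mul_fromCols] at hX
  have h12 := congrArg Matrix.toBlocks₁₂ hX
  have hadd : ∀ (A B : Matrix (ν ⊕ μ) (ν ⊕ μ) 𝕜), (A + B).toBlocks₁₂ = A.toBlocks₁₂ + B.toBlocks₁₂ := fun A B => rfl
  rw [hadd, toBlocks_fromBlocks₁₂] at h12
  show ((kkt (H - Fᵀ * W * F) Q)⁻¹).toBlocks₁₂ = ((kkt H Q)⁻¹).toBlocks₁₂ + _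
  rw [h12]
  simp only [flucCov, minOp, Matrix.mul_assoc]

/-- [folklore] **THE LEFT COMPANION UNDER THE WEIGHTED DOWNDATE** (the `₂₁` corner): with `𝓘ᴸ := minOpL H Q`,
`minOpL (H − FᵀWF) Q = 𝓘ᴸ + 𝓘ᴸ·Fᵀ·K·F·Γ₀`. -/
theorem minOpL_weighted_downdate (H : Matrix ν ν 𝕜) (Q : Matrix μ ν 𝕜) (F : Matrix κ ν 𝕜) (W : Matrix κ κ 𝕜)
    (h : IsUnit (kkt H Q).det) (hW : IsUnit W.det) (hM : IsUnit (W⁻¹ - F * flucCov H Q * Fᵀ).det) :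
    minOpL (H - Fᵀ * W * F) Q = minOpL H Q + minOpL H Q * Fᵀ * (W⁻¹ - F * flucCov H Q * Fᵀ)⁻¹ * F * flucCov H Q := by
  have hX := kktInv_weighted_downdate H Q F W h hW hM
  rw [fromRows_mul, fromRows_mul_fromCols] at hX
  have h21 := congrArg Matrix.toBlocks₂₁ hX
  have hadd : ∀ (A B : Matrix (ν ⊕ μ) (ν ⊕ μ) 𝕜), (A + B).toBlocks₂₁ = A.toBlocks₂₁ + B.toBlocks₂₁ := fun A B => rfl
  rw [hadd, toBlocks_fromBlocks₂₁] at h21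
  show ((kkt (H - Fᵀ * W * F) Q)⁻¹).toBlocks₂₁ = ((kkt H Q)⁻¹).toBlocks₂₁ + _
  rw [h21]
  simp only [flucCov, minOpL, Matrix.mul_assoc]

/-- [folklore] **THE EFFECTIVE FORM UNDER THE WEIGHTED DOWNDATE** (the `₂₂` corner; N7-PROOF v3.3 §2(b) «the λλ-block of `kkt(H_cov,Q)⁻¹` is
`−(G_C − Ξ)`»): with `G_C := effForm H Q`,  `effForm (H − FᵀWF) Q = G_C − 𝓘ᴸ·Fᵀ·K·F·𝓘`  — the INDUCED GAUGE FIXING `Ξ = 𝓘ᴸFᵀKF𝓘`, written out;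
hypotheses `IsUnit (kkt H Q).det`, `IsUnit W.det`, `IsUnit (W⁻¹ − FΓ₀Fᵀ).det` ONLY. -/
theorem effForm_weighted_downdate (H : Matrix ν ν 𝕜) (Q : Matrix μ ν 𝕜) (F : Matrix κ ν 𝕜) (W : Matrix κ κ 𝕜)
    (h : IsUnit (kkt H Q).det) (hW : IsUnit W.det) (hM : IsUnit (W⁻¹ - F * flucCov H Q * Fᵀ).det) :
    effForm (H - Fᵀ * W * F) Q = effForm H Q - minOpL H Q * Fᵀ * (W⁻¹ - F * flucCov H Q * Fᵀ)⁻¹ * F * minOp H Q := by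
  have hX := kktInv_weighted_downdate H Q F W h hW hM
  rw [fromRows_mul, fromRows_mul_fromCols] at hX
  have h22 := congrArg Matrix.toBlocks₂₂ hX
  have hadd : ∀ (A B : Matrix (ν ⊕ μ) (ν ⊕ μ) 𝕜), (A + B).toBlocks₂₂ = A.toBlocks₂₂ + B.toBlocks₂₂ := fun A B => rfl
  rw [hadd, toBlocks_fromBlocks₂₂] at h22
  show -((kkt (H - Fᵀ * W * F) Q)⁻¹).toBlocks₂₂ = -((kkt H Q)⁻¹).toBlocks₂₂ - _
  rw [h22, neg_add']
  simp only [minOp, minOpL, Matrix.mul_assoc]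

/-- [folklore] The minimiser in the memo's letters (`W := Mid⁻¹`, `K_C := (Mid − FΓ₀Fᵀ)⁻¹`):
`minOp (H − FᵀMid⁻¹F) Q = 𝓘 + Γ₀·Fᵀ·K_C·F·𝓘` under `IsUnit (kkt H Q).det`, `IsUnit Mid.det`, `IsUnit (Mid − FΓ₀Fᵀ).det`. -/
theorem minOp_sub_deficit (H : Matrix ν ν 𝕜) (Q : Matrix μ ν 𝕜) (F : Matrix κ ν 𝕜) (Mid : Matrix κ κ 𝕜)
    (h : IsUnit (kkt H Q).det) (hMid : IsUnit Mid.det) (hK : IsUnit (Mid - F * flucCov H Q * Fᵀ).det) :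
    minOp (H - Fᵀ * Mid⁻¹ * F) Q = minOp H Q + flucCov H Q * Fᵀ * (Mid - F * flucCov H Q * Fᵀ)⁻¹ * F * minOp H Q := by
  have hW : IsUnit (Mid⁻¹).det := (Matrix.isUnit_nonsing_inv_det_iff (A := Mid)).mpr hMid
  have e : Mid⁻¹⁻¹ = Mid := Matrix.nonsing_inv_nonsing_inv Mid hMid
  have hM : IsUnit (Mid⁻¹⁻¹ - F * flucCov H Q * Fᵀ).det := by rw [e]; exact hK
  rw [minOp_weighted_downdate H Q F Mid⁻¹ h hW hM, e]

/-- [folklore] **`𝔊 = G_C − Ξ` IN THE MEMO's LETTERS** (`W := Mid⁻¹`): `effForm (H − FᵀMid⁻¹F) Q = effForm H Q − 𝓘ᴸ·Fᵀ·K_C·F·𝓘`,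
`K_C := (Mid − FΓ₀Fᵀ)⁻¹`, under `IsUnit (kkt H Q).det`, `IsUnit Mid.det`, `IsUnit (Mid − FΓ₀Fᵀ).det`. -/
theorem effForm_sub_deficit (H : Matrix ν ν 𝕜) (Q : Matrix μ ν 𝕜) (F : Matrix κ ν 𝕜) (Mid : Matrix κ κ 𝕜)
    (h : IsUnit (kkt H Q).det) (hMid : IsUnit Mid.det) (hK : IsUnit (Mid - F * flucCov H Q * Fᵀ).det) :
    effForm (H - Fᵀ * Mid⁻¹ * F) Q = effForm H Q - minOpL H Q * Fᵀ * (Mid - F * flucCov H Q * Fᵀ)⁻¹ * F * minOp H Q := by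
  have hW : IsUnit (Mid⁻¹).det := (Matrix.isUnit_nonsing_inv_det_iff (A := Mid)).mpr hMid
  have e : Mid⁻¹⁻¹ = Mid := Matrix.nonsing_inv_nonsing_inv Mid hMid
  have hM : IsUnit (Mid⁻¹⁻¹ - F * flucCov H Q * Fᵀ).det := by rw [e]; exact hK
  rw [effForm_weighted_downdate H Q F Mid⁻¹ h hW hM, e]

/-! ## §2 Ξ in the memo's letters, its sign, and the value reading -/

omit [DecidableEq κ] in
/-- [folklore] **Ξ IS A SANDWICH** for symmetric `H`: `𝓘ᴸ·Fᵀ·K·F·𝓘 = (F𝓘)ᵀ·K·(F𝓘)` (any `K`; `minOpL = minOpᵀ` by `minOpL_eq_transpose`). -/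
theorem xi_eq_sandwich (H : Matrix ν ν 𝕜) (Q : Matrix μ ν 𝕜) (F : Matrix κ ν 𝕜) (K : Matrix κ κ 𝕜) (hHs : Hᵀ = H) :
    minOpL H Q * Fᵀ * K * F * minOp H Q = (F * minOp H Q)ᵀ * K * (F * minOp H Q) := by
  rw [(minOpL_eq_transpose H Q hHs).1, transpose_mul]
  simp only [Matrix.mul_assoc]

omit [DecidableEq κ] in
/-- [folklore] **Ξ IN THE COARSE RAW LETTERS OF IR-3-ID**: for invertible symmetric `H` with `blockProp H Q = QH⁻¹Qᵀ` invertible and ANY `K`,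
`𝓘ᴸ·Fᵀ·K·F·𝓘 = G_C·S₀·K·S₀ᵀ·G_C` with `G_C := (blockProp H Q)⁻¹`, `S₀ := Q H⁻¹ Fᵀ` — at `K = K_C` this is the memo's `Ξ = G_C d^c L_C⁻¹ d^{cT} G_C`
read through the road dictionary `S₀ = d^c·Mid`, `L_C⁻¹ = Mid·K_C·Mid` (displayed there; nothing of it asserted here). -/
theorem xi_eq_coarse_sandwich (H : Matrix ν ν 𝕜) (Q : Matrix μ ν 𝕜) (F : Matrix κ ν 𝕜) (K : Matrix κ κ 𝕜) (hH : IsUnit H.det)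
    (hP : IsUnit (blockProp H Q).det) (hHs : Hᵀ = H) :
    minOpL H Q * Fᵀ * K * F * minOp H Q
      = (blockProp H Q)⁻¹ * (Q * H⁻¹ * Fᵀ) * K * (Q * H⁻¹ * Fᵀ)ᵀ * (blockProp H Q)⁻¹ := by
  have hPs : (H⁻¹)ᵀ = H⁻¹ := by rw [transpose_nonsing_inv, hHs]
  have hBs : (blockProp H Q)ᵀ = blockProp H Q := by
    simp only [blockProp, transpose_mul, transpose_transpose, hPs, Matrix.mul_assoc]
  have hGs : ((blockProp H Q)⁻¹)ᵀ = (blockProp H Q)⁻¹ := by rw [transpose_nonsing_inv, hBs]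
  obtain ⟨-, h2, h3, -⟩ := blocks_eq_of_inv H Q hH hP
  rw [h2, h3]
  simp only [minMap, minMapL, transpose_mul, transpose_transpose, hPs, Matrix.mul_assoc]

/-- [folklore] **`Ξ ⪰ 0`** (N7-PROOF v3.3 §2(b)), over `ℝ`: for symmetric `H`, if the residual-mode matrix `Mid − F·flucCov H Q·Fᵀ` is positive definite
then `Ξ = 𝓘ᴸ·Fᵀ·(Mid − FΓ₀Fᵀ)⁻¹·F·𝓘` is positive semidefinite. -/
theorem posSemidef_xi (H : Matrix ν ν ℝ) (Q : Matrix μ ν ℝ) (F : Matrix κ ν ℝ) (Mid : Matrix κ κ ℝ) (hHs : Hᵀ = H)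
    (hKC : (Mid - F * flucCov H Q * Fᵀ).PosDef) :
    (minOpL H Q * Fᵀ * (Mid - F * flucCov H Q * Fᵀ)⁻¹ * F * minOp H Q).PosSemidef := by
  rw [xi_eq_sandwich H Q F _ hHs, ← conjTranspose_eq_transpose_of_trivial]
  exact hKC.inv.posSemidef.conjTranspose_mul_mul_same _

/-- [folklore] **THE VALUE READING OF `𝔊`**: `effForm (H − FᵀWF) Q = (𝓘^{cov})ᵀ·(H − FᵀWF)·𝓘^{cov}`, `𝓘^{cov} := minOp (H − FᵀWF) Q` — the effective
form of the downdated datum is the downdated fine form evaluated on its own constrained critical point (`transpose_minOp_mul_mul_minOp` BY NAME;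
the variational half «= the constrained minimum» is row RHOA-1b and is NOT restated here). -/
theorem effForm_weighted_downdate_eq_value (H : Matrix ν ν 𝕜) (Q : Matrix μ ν 𝕜) (F : Matrix κ ν 𝕜) (W : Matrix κ κ 𝕜)
    (h : IsUnit (kkt H Q).det) (hW : IsUnit W.det) (hM : IsUnit (W⁻¹ - F * flucCov H Q * Fᵀ).det) :
    effForm (H - Fᵀ * W * F) Q = (minOp (H - Fᵀ * W * F) Q)ᵀ * (H - Fᵀ * W * F) * minOp (H - Fᵀ * W * F) Q :=
  (transpose_minOp_mul_mul_minOp _ Q (isUnit_det_kkt_weighted_downdate H Q F W h hW hM)).symm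

/-! ## §3 The regrouping letter of N7-PROOF v3.3 §2(a): gluon-vertex loops regroup onto the legs `Γ₀ + R̃`, whatever `R̃` is -/

section Regroup

variable {ι : Type*} [Fintype ι]

/-- [folklore] `tr(X·V·Y·V) = tr(Y·V·X·V)` (cyclicity, the one symmetry the regrouping uses). -/
theorem trace_bubble_comm (X Y V : Matrix ι ι ℝ) : (X * V * Y * V).trace = (Y * V * X * V).trace := by
  rw [show X * V * Y * V = (X * V) * (Y * V) by simp only [Matrix.mul_assoc], Matrix.trace_mul_comm]
  simp only [Matrix.mul_assoc]

/-- [folklore] **THE REGROUPING** (N7-PROOF v3.3 §2(a), the displayed loops verbatim): for ANY square `P R^Q R̃` and vertices `H₁ H₂`, with `Γ₀ := P − R^Q`,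
`[½tr(PH₁PH₁) − ½tr(PH₂)] − [−½tr(R^QH₁R^QH₁) + tr(R^QH₁PH₁) − ½tr(R^QH₂)] − [−½tr(R̃H₁R̃H₁) − tr(R̃H₁Γ₀H₁) + ½tr(R̃H₂)]
= ½tr((Γ₀+R̃)H₁(Γ₀+R̃)H₁) − ½tr((Γ₀+R̃)H₂)` — «T¹ − K̃ ∋ ½tr((Γ₀+R̃)Ḣ(Γ₀+R̃)Ḣ) − ½tr((Γ₀+R̃)Ḧ)»: unconstrained fine loops minus the C-sector loops
minus the L-sector loops are the one shot's gluon-vertex loops with legs `Γ₀ + R̃`.  Pure trace algebra; which `R̃` is the right one is §4's business. -/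
theorem gluonLoops_regroup (P RQ Rt H₁ H₂ : Matrix ι ι ℝ) :
    ((1 / 2 : ℝ) * (P * H₁ * P * H₁).trace - (1 / 2 : ℝ) * (P * H₂).trace)
      - (-(1 / 2 : ℝ) * (RQ * H₁ * RQ * H₁).trace + (RQ * H₁ * P * H₁).trace - (1 / 2 : ℝ) * (RQ * H₂).trace)
      - (-(1 / 2 : ℝ) * (Rt * H₁ * Rt * H₁).trace - (Rt * H₁ * (P - RQ) * H₁).trace + (1 / 2 : ℝ) * (Rt * H₂).trace)
    = (1 / 2 : ℝ) * ((P - RQ + Rt) * H₁ * (P - RQ + Rt) * H₁).trace - (1 / 2 : ℝ) * ((P - RQ + Rt) * H₂).trace := by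
  have c1 : (P * H₁ * RQ * H₁).trace = (RQ * H₁ * P * H₁).trace := trace_bubble_comm P RQ H₁
  have c2 : (P * H₁ * Rt * H₁).trace = (Rt * H₁ * P * H₁).trace := trace_bubble_comm P Rt H₁
  have c3 : (RQ * H₁ * Rt * H₁).trace = (Rt * H₁ * RQ * H₁).trace := trace_bubble_comm RQ Rt H₁
  simp only [Matrix.add_mul, Matrix.sub_mul, Matrix.mul_add, Matrix.mul_sub, Matrix.trace_add, Matrix.trace_sub, c1, c2, c3]
  ring

end Regroup

/-! ## §4 LOCATED: `R^g` versus `A·Ξ·Aᵀ` -/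

omit [DecidableEq κ] [DecidableEq ν] in
/-- [folklore] THE EXPANSION (pure ring algebra): for any `P R^Q : ν × ν`, `F : κ × ν`, `K : κ × κ`,
`(P − R^Q)·Fᵀ·K·F·(P − R^Q) = R^Q·Fᵀ·K·F·R^Q + (P·Fᵀ·K·F·P − P·Fᵀ·K·F·R^Q − R^Q·Fᵀ·K·F·P)`. -/
theorem sub_sandwich_expand (P RQ : Matrix ν ν 𝕜) (F : Matrix κ ν 𝕜) (K : Matrix κ κ 𝕜) :
    (P - RQ) * Fᵀ * K * F * (P - RQ)
      = RQ * Fᵀ * K * F * RQ + (P * Fᵀ * K * F * P - P * Fᵀ * K * F * RQ - RQ * Fᵀ * K * F * P) := by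
  simp only [Matrix.sub_mul, Matrix.mul_sub]
  abel

/-- [folklore] **`R^g = A·Ξ·Aᵀ + (three raw-leg terms)`, EXACTLY** (the located status of N7-PROOF v3.3 §2(a) «`R̃ := AΞAᵀ = R^g`»): for invertible
symmetric `H` with `blockProp H Q`, `Mid` and `Mid − F·flucCov H Q·Fᵀ` invertible, writing `P := H⁻¹`, `A := PQᵀ`, `R^Q := minMap H Q·Q·P`,
`K_C := (Mid − FΓ₀Fᵀ)⁻¹`, `Ξ := 𝓘ᴸFᵀK_CF𝓘`:
`flucCov (H − FᵀMid⁻¹F) Q − flucCov H Q = A·Ξ·Aᵀ + (P·Fᵀ·K_C·F·P − P·Fᵀ·K_C·F·R^Q − R^Q·Fᵀ·K_C·F·P)`.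
The three extra terms each carry at least one RAW leg `P·Fᵀ` ∕ `F·P`; they do not vanish for generic data (exact-rational witness in the journal). -/
theorem resCov_eq_conj_xi_add (H : Matrix ν ν 𝕜) (Q : Matrix μ ν 𝕜) (F : Matrix κ ν 𝕜) (Mid : Matrix κ κ 𝕜) (hH : IsUnit H.det)
    (hP : IsUnit (blockProp H Q).det) (hHs : Hᵀ = H) (hMid : IsUnit Mid.det) (hK : IsUnit (Mid - F * flucCov H Q * Fᵀ).det) :
    flucCov (H - Fᵀ * Mid⁻¹ * F) Q - flucCov H Q
      = (H⁻¹ * Qᵀ) * (minOpL H Q * Fᵀ * (Mid - F * flucCov H Q * Fᵀ)⁻¹ * F * minOp H Q) * (H⁻¹ * Qᵀ)ᵀ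
        + (H⁻¹ * Fᵀ * (Mid - F * flucCov H Q * Fᵀ)⁻¹ * F * H⁻¹
            - H⁻¹ * Fᵀ * (Mid - F * flucCov H Q * Fᵀ)⁻¹ * F * (minMap H Q * Q * H⁻¹)
            - (minMap H Q * Q * H⁻¹) * Fᵀ * (Mid - F * flucCov H Q * Fᵀ)⁻¹ * F * H⁻¹) := by
  have h : IsUnit (kkt H Q).det := isUnit_iff_ne_zero.mpr (det_kkt_ne_zero H Q hH hP)
  have hPs : (H⁻¹)ᵀ = H⁻¹ := by rw [transpose_nonsing_inv, hHs]
  have hBs : (blockProp H Q)ᵀ = blockProp H Q := by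
    simp only [blockProp, transpose_mul, transpose_transpose, hPs, Matrix.mul_assoc]
  have hGs : ((blockProp H Q)⁻¹)ᵀ = (blockProp H Q)⁻¹ := by rw [transpose_nonsing_inv, hBs]
  obtain ⟨-, h2, h3, h4⟩ := blocks_eq_of_inv H Q hH hP
  -- the left-hand side is `Γ₀FᵀK_CFΓ₀` with `Γ₀ = P − R^Q`
  rw [flucCov_sub_deficit H Q F Mid h hMid hK, add_sub_cancel_left, h4]
  set K := (Mid - F * constrProp H Q * Fᵀ)⁻¹
  -- `A·Ξ·Aᵀ = R^Q·Fᵀ·K·F·R^Q`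
  have hAXA : (H⁻¹ * Qᵀ) * (minOpL H Q * Fᵀ * K * F * minOp H Q) * (H⁻¹ * Qᵀ)ᵀ
      = (minMap H Q * Q * H⁻¹) * Fᵀ * K * F * (minMap H Q * Q * H⁻¹) := by
    rw [h2, h3]
    simp only [minMap, minMapL, transpose_mul, transpose_transpose, hPs, Matrix.mul_assoc]
  rw [hAXA]
  unfold constrProp
  rw [sub_sandwich_expand]

/-- [folklore] **WHERE `R^g = AΞAᵀ` DOES HOLD**: against legs killed by `F·P`.  Under the hypotheses of `resCov_eq_conj_xi_add`, for test matrices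
`X`, `Y` with `F·H⁻¹·X = 0` and `F·H⁻¹·Y = 0`:  `Xᵀ·(Γ^{cov} − Γ₀)·Y = Xᵀ·(A·Ξ·Aᵀ)·Y`.  (On the road `F·H⁻¹ = Q′Δ⁻²d^*` by the BF Ward identity,
so the condition reads «`X`, `Y` transverse»; the identity is NOT a matrix identity — see the module docstring.) -/
theorem transpose_mul_resCov_mul_eq {ρ ρ' : Type*} (H : Matrix ν ν 𝕜) (Q : Matrix μ ν 𝕜) (F : Matrix κ ν 𝕜) (Mid : Matrix κ κ 𝕜)
    (hH : IsUnit H.det) (hP : IsUnit (blockProp H Q).det) (hHs : Hᵀ = H) (hMid : IsUnit Mid.det)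
    (hK : IsUnit (Mid - F * flucCov H Q * Fᵀ).det) (X : Matrix ν ρ 𝕜) (Y : Matrix ν ρ' 𝕜)
    (hX : F * H⁻¹ * X = 0) (hY : F * H⁻¹ * Y = 0) :
    Xᵀ * (flucCov (H - Fᵀ * Mid⁻¹ * F) Q - flucCov H Q) * Y
      = Xᵀ * ((H⁻¹ * Qᵀ) * (minOpL H Q * Fᵀ * (Mid - F * flucCov H Q * Fᵀ)⁻¹ * F * minOp H Q) * (H⁻¹ * Qᵀ)ᵀ) * Y := by
  have hPs : (H⁻¹)ᵀ = H⁻¹ := by rw [transpose_nonsing_inv, hHs]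
  have hXt : Xᵀ * H⁻¹ * Fᵀ = 0 := by
    have e := congrArg Matrix.transpose hX
    rwa [transpose_mul, transpose_mul, hPs, transpose_zero, ← Matrix.mul_assoc] at e
  rw [resCov_eq_conj_xi_add H Q F Mid hH hP hHs hMid hK, Matrix.mul_add, Matrix.add_mul, add_eq_left]
  set K := (Mid - F * flucCov H Q * Fᵀ)⁻¹
  have hKY : K * (F * (H⁻¹ * Y)) = 0 := by rw [← Matrix.mul_assoc F, hY, Matrix.mul_zero]
  have hX' : ∀ M : Matrix κ ρ' 𝕜, Xᵀ * (H⁻¹ * (Fᵀ * M)) = 0 := fun M => by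
    rw [← Matrix.mul_assoc, ← Matrix.mul_assoc, hXt, Matrix.zero_mul]
  simp only [Matrix.mul_sub, Matrix.sub_mul, Matrix.mul_assoc, hKY, hX', Matrix.mul_zero, sub_self]


/-! ## §4b At loop level: the memo's gloss is exact against vertices that kill the raw legs -/

section LoopLevel

variable {ι : Type*} [Fintype ι]

omit [Fintype κ] [Fintype ν] [Fintype μ] [DecidableEq κ] [DecidableEq ν] [DecidableEq μ] in
/-- [folklore] SANDWICHES AGREE ⟹ BUBBLES AND CROSS-BUBBLES AGREE: if `V·R·V = V·S·V` then `tr(RVRV) = tr(SVSV)` and `tr(RVΓV) = tr(SVΓV)`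
for every `Γ` (cyclicity only). -/
theorem bubbles_eq_of_sandwich_eq (R S V Γ : Matrix ι ι 𝕜) (h : V * R * V = V * S * V) :
    (R * V * R * V).trace = (S * V * S * V).trace ∧ (R * V * Γ * V).trace = (S * V * Γ * V).trace := by
  constructor
  · calc (R * V * R * V).trace = (R * V * (S * V)).trace := by
          rw [show R * V * R * V = R * (V * R * V) by simp only [Matrix.mul_assoc], h]; simp only [Matrix.mul_assoc]
      _ = (S * V * (R * V)).trace := Matrix.trace_mul_comm _ _
      _ = (S * (V * S * V)).trace := by
          rw [show S * V * (R * V) = S * (V * R * V) by simp only [Matrix.mul_assoc], h]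
      _ = (S * V * S * V).trace := by simp only [Matrix.mul_assoc]
  · calc (R * V * Γ * V).trace = (V * R * V * Γ).trace := by
          rw [Matrix.trace_mul_comm (R * V * Γ) V]; simp only [Matrix.mul_assoc]
      _ = (V * S * V * Γ).trace := by rw [h]
      _ = (S * V * Γ * V).trace := by
          rw [Matrix.trace_mul_comm (S * V * Γ) V]; simp only [Matrix.mul_assoc]

end LoopLevel

/-- [folklore] **A VERTEX THAT KILLS THE RAW LEGS SEES `R^g` AS `AΞAᵀ`**: under the hypotheses of `resCov_eq_conj_xi_add`, for a symmetric vertex `H₁`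
with `F·H⁻¹·H₁ = 0` (REPAIR-A shape: on the road `F·H⁻¹ ∝ Q′Δ⁻²d^*`, so «`H₁` annihilates pure-gauge legs»), `H₁·R^g·H₁ = H₁·(AΞAᵀ)·H₁`. -/
theorem vertex_mul_resCov_mul_vertex (H : Matrix ν ν 𝕜) (Q : Matrix μ ν 𝕜) (F : Matrix κ ν 𝕜) (Mid : Matrix κ κ 𝕜)
    (hH : IsUnit H.det) (hP : IsUnit (blockProp H Q).det) (hHs : Hᵀ = H) (hMid : IsUnit Mid.det)
    (hK : IsUnit (Mid - F * flucCov H Q * Fᵀ).det) (H₁ : Matrix ν ν 𝕜) (hH₁s : H₁ᵀ = H₁) (hkill : F * H⁻¹ * H₁ = 0) :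
    H₁ * (flucCov (H - Fᵀ * Mid⁻¹ * F) Q - flucCov H Q) * H₁
      = H₁ * ((H⁻¹ * Qᵀ) * (minOpL H Q * Fᵀ * (Mid - F * flucCov H Q * Fᵀ)⁻¹ * F * minOp H Q) * (H⁻¹ * Qᵀ)ᵀ) * H₁ := by
  have e := transpose_mul_resCov_mul_eq H Q F Mid hH hP hHs hMid hK H₁ H₁ hkill hkill
  rwa [hH₁s] at e

/-- [folklore] **THE L-SECTOR LOOPS DO NOT SEE THE DIFFERENCE** (N7-PROOF v3.3 §2(a) made exact): under the hypotheses of `resCov_eq_conj_xi_add`,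
for symmetric vertices `H₁ H₂` that kill the raw legs (`F·H⁻¹·H₁ = 0`, `F·H⁻¹·H₂ = 0`), the three L-sector gluon-vertex loops — bubble `tr(R̃H₁R̃H₁)`,
cross-bubble `tr(R̃H₁Γ₀H₁)`, tadpole `tr(R̃H₂)` — take the SAME values at `R̃ = R^g` and at `R̃ = AΞAᵀ`.  (With slice jets inside the vertices the
hypothesis fails and the three raw-leg terms of `resCov_eq_conj_xi_add` must be carried — see the module docstring.) -/
theorem lsectorLoops_resCov_eq_conj_xi (H : Matrix ν ν 𝕜) (Q : Matrix μ ν 𝕜) (F : Matrix κ ν 𝕜) (Mid : Matrix κ κ 𝕜)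
    (hH : IsUnit H.det) (hP : IsUnit (blockProp H Q).det) (hHs : Hᵀ = H) (hMid : IsUnit Mid.det)
    (hK : IsUnit (Mid - F * flucCov H Q * Fᵀ).det) (H₁ H₂ : Matrix ν ν 𝕜) (hH₁s : H₁ᵀ = H₁) (hH₂s : H₂ᵀ = H₂)
    (hkill₁ : F * H⁻¹ * H₁ = 0) (hkill₂ : F * H⁻¹ * H₂ = 0) :
    ((flucCov (H - Fᵀ * Mid⁻¹ * F) Q - flucCov H Q) * H₁ * (flucCov (H - Fᵀ * Mid⁻¹ * F) Q - flucCov H Q) * H₁).trace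
        = ((H⁻¹ * Qᵀ) * (minOpL H Q * Fᵀ * (Mid - F * flucCov H Q * Fᵀ)⁻¹ * F * minOp H Q) * (H⁻¹ * Qᵀ)ᵀ * H₁
            * ((H⁻¹ * Qᵀ) * (minOpL H Q * Fᵀ * (Mid - F * flucCov H Q * Fᵀ)⁻¹ * F * minOp H Q) * (H⁻¹ * Qᵀ)ᵀ) * H₁).trace
      ∧ ((flucCov (H - Fᵀ * Mid⁻¹ * F) Q - flucCov H Q) * H₁ * flucCov H Q * H₁).trace
        = ((H⁻¹ * Qᵀ) * (minOpL H Q * Fᵀ * (Mid - F * flucCov H Q * Fᵀ)⁻¹ * F * minOp H Q) * (H⁻¹ * Qᵀ)ᵀ * H₁ * flucCov H Q * H₁).trace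
      ∧ ((flucCov (H - Fᵀ * Mid⁻¹ * F) Q - flucCov H Q) * H₂).trace
        = ((H⁻¹ * Qᵀ) * (minOpL H Q * Fᵀ * (Mid - F * flucCov H Q * Fᵀ)⁻¹ * F * minOp H Q) * (H⁻¹ * Qᵀ)ᵀ * H₂).trace := by
  have hPs : (H⁻¹)ᵀ = H⁻¹ := by rw [transpose_nonsing_inv, hHs]
  obtain ⟨hb, hc⟩ := bubbles_eq_of_sandwich_eq _ _ H₁ (flucCov H Q)
    (vertex_mul_resCov_mul_vertex H Q F Mid hH hP hHs hMid hK H₁ hH₁s hkill₁)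
  refine ⟨hb, hc, ?_⟩
  -- the tadpole: the three raw-leg terms die under `F·H⁻¹·H₂ = 0` and its transpose `H₂·H⁻¹·Fᵀ = 0`
  have hkt : H₂ * H⁻¹ * Fᵀ = 0 := by
    have e := congrArg Matrix.transpose hkill₂
    rwa [transpose_mul, transpose_mul, hPs, hH₂s, transpose_zero, ← Matrix.mul_assoc] at e
  have hkF : F * (H⁻¹ * H₂) = 0 := by rw [← Matrix.mul_assoc, hkill₂]
  have hkt' : ∀ M : Matrix κ ν 𝕜, H₂ * (H⁻¹ * (Fᵀ * M)) = 0 := fun M => by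
    rw [← Matrix.mul_assoc, ← Matrix.mul_assoc, hkt, Matrix.zero_mul]
  rw [resCov_eq_conj_xi_add H Q F Mid hH hP hHs hMid hK, Matrix.add_mul, Matrix.trace_add, add_eq_left]
  set K := (Mid - F * flucCov H Q * Fᵀ)⁻¹
  set RQ := minMap H Q * Q * H⁻¹
  rw [Matrix.sub_mul, Matrix.sub_mul, Matrix.trace_sub, Matrix.trace_sub, Matrix.trace_mul_comm (H⁻¹ * Fᵀ * K * F * RQ) H₂]
  simp only [Matrix.mul_assoc, hkF, hkt', Matrix.mul_zero, Matrix.trace_zero, sub_self]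

/-! ## §5 (v1.1) The induced effective form kills the coarse raw legs -/

/-- [folklore] **`𝔊·S₀ = 0` UNDER (I2)** (v1.1; the junction re-proved by the RHOA-10b cross-reader t4-ne7b-formalise-leaf-04-g19, journal l.24297 P1,
here made a tree theorem): for invertible symmetric `H` with `blockProp H Q` invertible, raw deficit rows with `F·H⁻¹·Fᵀ = Mid` ((I2)'s hypothesis),
`Mid` and `Mid − FΓ₀Fᵀ` invertible, the effective form of the downdated datum annihilates the coarse raw legs `S₀ := Q·H⁻¹·Fᵀ`:
`effForm (H − FᵀMid⁻¹F) Q · S₀ = 0` — by §1–§2 `𝔊 = G_C − G_C·S₀·K_C·S₀ᵀ·G_C` and (I2) `S₀ᵀ·G_C·S₀ = K_C⁻¹`.  (Road reading, orientation only: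
`S₀ = d^c·Mid`, so `𝔊 = n⁻⁴Δ_∞^c` kills the coarse pure gauges — the induced form is coarse-gauge-invariant.) -/
theorem effForm_sub_deficit_mul_coarseLeg (H : Matrix ν ν 𝕜) (Q : Matrix μ ν 𝕜) (F : Matrix κ ν 𝕜) (Mid : Matrix κ κ 𝕜)
    (hH : IsUnit H.det) (hP : IsUnit (blockProp H Q).det) (hHs : Hᵀ = H) (hF : F * H⁻¹ * Fᵀ = Mid) (hMid : IsUnit Mid.det)
    (hK : IsUnit (Mid - F * flucCov H Q * Fᵀ).det) :
    effForm (H - Fᵀ * Mid⁻¹ * F) Q * (Q * H⁻¹ * Fᵀ) = 0 := by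
  have h : IsUnit (kkt H Q).det := isUnit_iff_ne_zero.mpr (det_kkt_ne_zero H Q hH hP)
  have hI2 := ResidualModeIdentities.weight_sub_deficitCov_eq H Q F Mid hH hP hHs hF
  rw [effForm_sub_deficit H Q F Mid h hMid hK, xi_eq_coarse_sandwich H Q F _ hH hP hHs, (blocks_eq_of_inv H Q hH hP).1,
    Matrix.sub_mul, sub_eq_zero]
  have e : (blockProp H Q)⁻¹ * (Q * H⁻¹ * Fᵀ) * (Mid - F * flucCov H Q * Fᵀ)⁻¹ * (Q * H⁻¹ * Fᵀ)ᵀ * (blockProp H Q)⁻¹ * (Q * H⁻¹ * Fᵀ)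
      = (blockProp H Q)⁻¹ * (Q * H⁻¹ * Fᵀ)
          * ((Mid - F * flucCov H Q * Fᵀ)⁻¹ * ((Q * H⁻¹ * Fᵀ)ᵀ * (blockProp H Q)⁻¹ * (Q * H⁻¹ * Fᵀ))) := by
    simp only [Matrix.mul_assoc]
  rw [e, ← hI2, Matrix.nonsing_inv_mul _ hK, Matrix.mul_one]

end Summit.QuantumFields.BalabanUV.Beta.FP.InducedGaugeFixing
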